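import Mathlib
import Summits.ValiantsHypothesis.ValiantsHypothesis.Theorems.FifoMatchingNNDivisionHardFewSummandsLaw
import HarnessLib

/-!
# The one-cut rung WITH A LABEL COUNT, and the FEW-SUMMANDS LAW FOR UNIONS: `Q = conv(⋃_{k<K} Σ_{i<M} conv V_{k,i})` — convex hulls of
# quasi-polynomially many Minkowski sums of small polytopes are decided (crux `Theses.FifoMatching.NNDivisionHard`,
# stmt-ValiantsHypothesis-21181; COR level)

WHAT IS NEW.  Val-idea-40's one-cut rung (✓ `ExposedFibre.exposedFibreRung_holds` / `exposedFibreDecided_holds`) needs ALL maximisers of the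
admissible direction to be `J`-collinear (then the passenger's face is a segment: PROP A with TWO generators).  As leafhand-8-g2's exposure rung
with a count (✓ `…FewFlatsRung.corPolytope_add_genericFace_three_pow_le_card`) did for the flag rung, this file relativises it to a
LABELLING `π : J → T`: maximisers with the SAME label are `J`-collinear ⇒ the face is generated by `2|T|` points ⇒ `3^m ≤ 2|T|·(r+1)·2^m`
(the chamber certificate charges the labels).  Fed with the few-summands machinery (✓ `…FewSummandsLaw`: `summandBlind_exposedFibreBlind`,
`exists_oneBlock_avoiding`) this decides UNIONS of `K` product families — passengers `conv(⋃_k {w_k + Σ_i vtx k i (f i)})`: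

* ★ `labelledFibre_three_pow_le` — the one-cut rung with a label count;
* ★★★ `union_summands_three_pow_le` — `K` labels, `M` summands of `m ≥ 1` listed points per label, `(K·M·m²)·C(h−t−1,t−1) < C(h−1,t−1)`,
  `2 ≤ m'`, `1 ≤ t`, `m'·t ≤ h` ⇒ `3^{m'} ≤ 2K·(r+1)·2^{m'+1}`;
* ★★★ `union_summands_decided` — crux shape at `m' = 2L+4`, `L = (log₂h+C)^C`: if moreover `2K·8^L ≤ 9^L` then `2^L < r`.

NN reading (sibling, to come): `hh = Σ_{k<K} Π_{i<M} p_{k,i}` — SUMS of `K ≤ 2^((log₂ n+c)^c)`-many PRODUCTS of sparse factors (over `ℝ≥0`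
the support of a sum is the union of the supports, so `Newt(hh) = conv(⋃_k Σ_i Newt p_{k,i})`).

HONEST FRAMING: a certificate for a CLASS of passengers; COR-VIRTUAL / `CovZonoHard` OPEN; stmt-21181 `NNDivisionHard` OPEN; `NNNotVP` OPEN;
`VP ≠ VNP` NOT proved.  No definitions, no named facts, no sorry.  References: Kaibel–Weltge 2015 [KaibelWeltge2014]; Fiorini et al. 2015
[FioriniEtAl2015].
-/

set_option autoImplicit false

-- the mandated summit-side namespace repeats a component by design (single-problem summit)
set_option linter.dupNamespace false

noncomputable section

open Matrix Finset
open scoped Pointwise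

namespace Summit.ValiantsHypothesis.ValiantsHypothesis.Theorems.FifoMatching

namespace Summands

open Literature.Barriers.PneNP (HasEFOfSize)
open Literature.Combinatorics.Optimization (corPolytopeGraph corVec)
open Summit.ValiantsHypothesis.ValiantsHypothesis.Theorems.FifoMatching.XcDivision
  (dot_le_of_mem_convexHull convexHull_range_inter_eq corPolytopeGraph_top_add_hull_three_pow_le)
open Summit.ValiantsHypothesis.ValiantsHypothesis.Theorems.FifoMatching.LocatedFaceExposure
  (exists_blockDir funLeft_image_cor_blockFace convexHull_collinear_pair)
open Summit.ValiantsHypothesis.ValiantsHypothesis.Theorems.FifoMatching.ExposedFibre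
  (Jdir admissible_dot_le admissible_face_eq)
open Summit.ValiantsHypothesis.ValiantsHypothesis.Theorems.FifoMatching.FaceBlind
  (BlockConstSymGen Admissible exists_admissible_sep exists_oneBlock_avoiding one_le_L)

variable {h : ℕ}

/-! ## §1 The one-cut rung WITH A LABEL COUNT -/

/-- ★ **ONE-CUT RUNG WITH A LABEL COUNT.**  If `c` is admissible for the block map `β` (section `ρ`), the generators are labelled by
`π : J → T`, and any two `c`-maximising generators WITH THE SAME LABEL differ by a multiple of `J`, then an extended formulation of
`COR(K_n) + conv q` of size `r` forces `3^m ≤ 2|T|·(r+1)·2^m`: the block face reads onto `COR(K_m)`, the passenger's face is generated by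
the two extreme points of each label's `J`-line, and the chamber certificate charges these `2|T|` generators.  (`|T| = 1`: ✓
`exposedFibreDecided_holds`.) [cite: KaibelWeltge2014, Thm. 1] -/
theorem labelledFibre_three_pow_le (n m : ℕ) (β : Fin n → Fin m) (ρ : Fin m → Fin n) (hρ : ∀ t, β (ρ t) = t)
    {J T : Type} [Fintype J] [Nonempty J] [DecidableEq J] [Fintype T] [DecidableEq T]
    (q : J → (Fin n × Fin n → ℝ)) (π : J → T) (r : ℕ) (c : Fin n × Fin n → ℝ) (hc : Admissible β c)
    (hthin : ∀ j j', (∀ k, c ⬝ᵥ q k ≤ c ⬝ᵥ q j) → (∀ k, c ⬝ᵥ q k ≤ c ⬝ᵥ q j') → π j = π j' →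
      ∃ α : ℝ, q j - q j' = α • Jdir n)
    (hEF : HasEFOfSize (corPolytopeGraph (⊤ : SimpleGraph (Fin n)) + convexHull ℝ (Set.range q)) r) :
    3 ^ m ≤ 2 * Fintype.card T * (r + 1) * 2 ^ m := by
  classical
  obtain ⟨B, hB⟩ := exists_blockDir β
  obtain ⟨j₀, -, hmax⟩ :=
    Finset.exists_max_image Finset.univ (fun j => c ⬝ᵥ q j) Finset.univ_nonempty
  have hQ : ∀ y ∈ convexHull ℝ (Set.range q), c ⬝ᵥ y ≤ c ⬝ᵥ q j₀ :=
    dot_le_of_mem_convexHull _ _ _ (by rintro _ ⟨j, rfl⟩; exact hmax j (Finset.mem_univ _))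
  have hP : ∀ x ∈ corPolytopeGraph (⊤ : SimpleGraph (Fin n)), c ⬝ᵥ x ≤ 0 :=
    dot_le_of_mem_convexHull _ _ _ (by rintro _ ⟨b, rfl⟩; exact admissible_dot_le hc b)
  have h0 := hEF.face_add_face₁ c 0 (c ⬝ᵥ q j₀) hP hQ
  rw [admissible_face_eq hc hB] at h0
  -- the top set and its labels
  let Top : Finset J := Finset.univ.filter fun j => c ⬝ᵥ q j = c ⬝ᵥ q j₀
  have hj₀ : j₀ ∈ Top := Finset.mem_filter.2 ⟨Finset.mem_univ _, rfl⟩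
  have hSmax : ∀ j ∈ Top, ∀ k, c ⬝ᵥ q k ≤ c ⬝ᵥ q j := fun j hj k => by
    rw [(Finset.mem_filter.1 hj).2]; exact hmax k (Finset.mem_univ _)
  -- per label present on the top: a representative and the collinear pair
  let Lab : Finset T := Top.image π
  have hrep : ∀ t : T, ∃ jt : J, t ∈ Lab → jt ∈ Top ∧ π jt = t := by
    intro t
    by_cases ht : t ∈ Lab
    · obtain ⟨j, hj, hjt⟩ := Finset.mem_image.1 ht
      exact ⟨j, fun _ => ⟨hj, hjt⟩⟩
    · exact ⟨j₀, fun h => (ht h).elim⟩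
  choose rep hrep using hrep
  -- on each label class of the top, the points are `q (rep t) + α • J`
  have hαex : ∀ j, ∃ α : ℝ, j ∈ Top → q j = q (rep (π j)) + α • Jdir n := by
    intro j
    by_cases hj : j ∈ Top
    · have ht : π j ∈ Lab := Finset.mem_image.2 ⟨j, hj, rfl⟩
      obtain ⟨hrt, hπt⟩ := hrep (π j) ht
      obtain ⟨α, hα⟩ := hthin j (rep (π j)) (hSmax j hj) (hSmax _ hrt) hπt.symm
      exact ⟨α, fun _ => by rw [← hα]; abel⟩
    · exact ⟨0, fun h => (hj h).elim⟩
  choose α hα using hαex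
  have hpair : ∀ t ∈ Lab, ∃ a ∈ Top.filter (fun j => π j = t), ∃ b ∈ Top.filter (fun j => π j = t),
      convexHull ℝ (q '' ((Top.filter fun j => π j = t : Finset J) : Set J)) = convexHull ℝ {q a, q b} := by
    intro t ht
    obtain ⟨hrt, hπt⟩ := hrep t ht
    refine convexHull_collinear_pair q (Jdir n) _ ⟨rep t, Finset.mem_filter.2 ⟨hrt, hπt⟩⟩ α (q (rep t)) ?_
    intro j hj
    obtain ⟨hjT, hjt⟩ := Finset.mem_filter.1 hj
    have := hα j hjT
    rw [hjt] at this
    exact this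
  have hpair' : ∀ t : T, ∃ a b : J, t ∈ Lab → a ∈ Top ∧ b ∈ Top ∧
      convexHull ℝ (q '' ((Top.filter fun j => π j = t : Finset J) : Set J)) = convexHull ℝ {q a, q b} := by
    intro t
    by_cases ht : t ∈ Lab
    · obtain ⟨a, ha, b, hb, hab⟩ := hpair t ht
      exact ⟨a, b, fun _ => ⟨(Finset.mem_filter.1 ha).1, (Finset.mem_filter.1 hb).1, hab⟩⟩
    · exact ⟨j₀, j₀, fun h => (ht h).elim⟩
  choose ea eb hab using hpair'
  -- the `2|Lab|` extreme points generate the face of the passenger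
  let gens : ↥Lab × Bool → (Fin n × Fin n → ℝ) := fun tb => if tb.2 then q (ea tb.1.1) else q (eb tb.1.1)
  have hface : convexHull ℝ (Set.range q) ∩ {y | c ⬝ᵥ y = c ⬝ᵥ q j₀} = convexHull ℝ (Set.range gens) := by
    rw [convexHull_range_inter_eq q c _ (fun j => hmax j (Finset.mem_univ _))]
    apply Set.Subset.antisymm
    · refine convexHull_min ?_ (convex_convexHull ℝ _)
      rintro _ ⟨⟨j, hj⟩, rfl⟩
      have hjT : j ∈ Top := Finset.mem_filter.2 ⟨Finset.mem_univ _, hj⟩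
      have ht : π j ∈ Lab := Finset.mem_image.2 ⟨j, hjT, rfl⟩
      obtain ⟨-, -, habt⟩ := hab (π j) ht
      have hjin : q j ∈ convexHull ℝ (q '' ((Top.filter fun j' => π j' = π j : Finset J) : Set J)) :=
        subset_convexHull ℝ _ ⟨j, Finset.mem_coe.2 (Finset.mem_filter.2 ⟨hjT, rfl⟩), rfl⟩
      rw [habt] at hjin
      refine convexHull_mono ?_ hjin
      intro y hy
      rcases hy with rfl | hy
      · exact ⟨(⟨π j, ht⟩, true), by simp [gens]⟩
      · rw [Set.mem_singleton_iff] at hy; subst hy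
        exact ⟨(⟨π j, ht⟩, false), by simp [gens]⟩
    · refine convexHull_mono ?_
      rintro _ ⟨⟨⟨t, ht⟩, bit⟩, rfl⟩
      obtain ⟨haT, hbT, -⟩ := hab t ht
      cases bit
      · exact ⟨⟨eb t, (Finset.mem_filter.1 hbT).2⟩, by simp [gens]⟩
      · exact ⟨⟨ea t, (Finset.mem_filter.1 haT).2⟩, by simp [gens]⟩
  rw [hface] at h0
  -- read the block face onto `COR(K_m)` and apply the chamber certificate with `2|Lab|` generators
  have h2 := h0.image_linearMap (LinearMap.funLeft ℝ ℝ (fun ij : Fin m × Fin m => (ρ ij.1, ρ ij.2)))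
  rw [Set.image_add, funLeft_image_cor_blockFace β hB hρ, LinearMap.image_convexHull, ← Set.range_comp] at h2
  haveI : Nonempty (↥Lab × Bool) := ⟨(⟨π j₀, Finset.mem_image.2 ⟨j₀, hj₀, rfl⟩⟩, true)⟩
  obtain ⟨K, e⟩ : ∃ K, Nonempty ((↥Lab × Bool) ≃ Fin (K + 1)) := by
    refine ⟨Fintype.card (↥Lab × Bool) - 1, ⟨(Fintype.equivFin _).trans (finCongr ?_)⟩⟩
    have : 0 < Fintype.card (↥Lab × Bool) := Fintype.card_pos
    omega
  obtain ⟨e⟩ := e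
  have hr : Set.range ((⇑(LinearMap.funLeft ℝ ℝ (fun ij : Fin m × Fin m => (ρ ij.1, ρ ij.2))) ∘ gens) ∘ e.symm) =
      Set.range (⇑(LinearMap.funLeft ℝ ℝ (fun ij : Fin m × Fin m => (ρ ij.1, ρ ij.2))) ∘ gens) :=
    e.symm.surjective.range_comp _
  rw [← hr] at h2
  have hA := corPolytopeGraph_top_add_hull_three_pow_le _ (Nat.succ_pos K) h2
  have hK : K + 1 ≤ 2 * Fintype.card T := by
    have e1 : K + 1 = Fintype.card (↥Lab × Bool) := by
      rw [← Fintype.card_fin (K + 1)]; exact (Fintype.card_congr e).symm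
    rw [e1, Fintype.card_prod, Fintype.card_bool, Fintype.card_coe, mul_comm]
    exact Nat.mul_le_mul_left 2 ((Finset.card_le_univ Lab).trans_eq (Finset.card_univ))
  calc 3 ^ m ≤ (K + 1) * (r + 1) * 2 ^ m := hA
    _ ≤ 2 * Fintype.card T * (r + 1) * 2 ^ m :=
        Nat.mul_le_mul_right _ (Nat.mul_le_mul_right _ hK)

/-! ## §2 The FEW-SUMMANDS LAW FOR UNIONS of product families -/

/-- ★★★ **FEW-SUMMANDS LAW FOR UNIONS (PROVED, unconditional):** for a passenger `Q = conv(⋃_{k<K} {w k + Σ_i vtx k i (f i) : f})`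
(`K ≥ 1` labels, `M` summands of `m ≥ 1` listed points per label; ANY vectors), `2 ≤ m'`, `1 ≤ t`, `m'·t ≤ h` and
`(K·(M·m²))·C(h−t−1,t−1) < C(h−1,t−1)`: every size-`r` extended formulation of `COR(K_h) + Q` has `3^{m'} ≤ 2K·(r+1)·2^{m'+1}`.
[cite: KaibelWeltge2014, Thm. 1] -/
theorem union_summands_three_pow_le (h m' t K M m : ℕ) (vtx : Fin K → Fin M → Fin m → (Fin h × Fin h → ℝ))
    (w : Fin K → (Fin h × Fin h → ℝ)) (r : ℕ) (hm' : 2 ≤ m') (ht : 1 ≤ t) (hh : m' * t ≤ h) (hK : 1 ≤ K) (hm : 1 ≤ m)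
    (hcount : (K * (M * (m * m))) * Nat.choose (h - t - 1) (t - 1) < Nat.choose (h - 1) (t - 1))
    (hEF : HasEFOfSize (corPolytopeGraph (⊤ : SimpleGraph (Fin h)) +
      convexHull ℝ (Set.range fun kf : Fin K × (Fin M → Fin m) => w kf.1 + ∑ i, vtx kf.1 i (kf.2 i))) r) :
    3 ^ m' ≤ 2 * K * (r + 1) * 2 ^ (m' + 1) := by
  classical
  -- all within-summand differences, over all labels, as ONE finite family
  let eD : Fin K × (Fin M × (Fin m × Fin m)) ≃ Fin (K * (M * (m * m))) :=
    (Equiv.prodCongr (Equiv.refl _) ((Equiv.prodCongr (Equiv.refl _) finProdFinEquiv).trans finProdFinEquiv)).trans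
      finProdFinEquiv
  let gen : Fin (K * (M * (m * m))) → (Fin h × Fin h → ℝ) := fun s =>
    vtx (eD.symm s).1 (eD.symm s).2.1 (eD.symm s).2.2.1 - vtx (eD.symm s).1 (eD.symm s).2.1 (eD.symm s).2.2.2
  obtain ⟨β, ρ, hρ, hZ⟩ := exists_oneBlock_avoiding h m' t _ hm' ht hh gen hcount
  have hbl : ∀ k i a b, BlockConstSymGen β (vtx k i a - vtx k i b) → ∃ α : ℝ, vtx k i a - vtx k i b = α • Jdir h := by
    intro k i a b hb
    have hgen : gen (eD (k, (i, (a, b)))) = vtx k i a - vtx k i b := by simp only [gen, Equiv.symm_apply_apply]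
    have := hZ (eD (k, (i, (a, b)))) (by rw [hgen]; exact hb)
    rwa [hgen] at this
  -- the generic admissible separator for the whole difference family
  obtain ⟨c, hc, hsep⟩ := exists_admissible_sep (n := h) (m := m') β gen
  haveI : Nonempty (Fin K × (Fin M → Fin m)) := ⟨(⟨0, hK⟩, fun _ => ⟨0, hm⟩)⟩
  -- same label + both maximising ⇒ each coordinate difference unseen by `c` ⇒ in `ℝJ`
  have hthin : ∀ j j' : Fin K × (Fin M → Fin m),
      (∀ kf : Fin K × (Fin M → Fin m), c ⬝ᵥ (w kf.1 + ∑ i, vtx kf.1 i (kf.2 i)) ≤ c ⬝ᵥ (w j.1 + ∑ i, vtx j.1 i (j.2 i))) →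
      (∀ kf : Fin K × (Fin M → Fin m), c ⬝ᵥ (w kf.1 + ∑ i, vtx kf.1 i (kf.2 i)) ≤ c ⬝ᵥ (w j'.1 + ∑ i, vtx j'.1 i (j'.2 i))) →
      j.1 = j'.1 → ∃ α : ℝ, (w j.1 + ∑ i, vtx j.1 i (j.2 i)) - (w j'.1 + ∑ i, vtx j'.1 i (j'.2 i)) = α • Jdir h := by
    rintro ⟨k, f⟩ ⟨k', f'⟩ hf hf' hkk
    simp only at hkk
    subst hkk
    have hfall : ∀ g : Fin M → Fin m, c ⬝ᵥ (w k + ∑ i, vtx k i (g i)) ≤ c ⬝ᵥ (w k + ∑ i, vtx k i (f i)) :=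
      fun g => hf (k, g)
    have hf'all : ∀ g : Fin M → Fin m, c ⬝ᵥ (w k + ∑ i, vtx k i (g i)) ≤ c ⬝ᵥ (w k + ∑ i, vtx k i (f' i)) :=
      fun g => hf' (k, g)
    have hcoord : ∀ i, ∃ α : ℝ, vtx k i (f i) - vtx k i (f' i) = α • Jdir h := by
      intro i
      have h1 := maximiser_coord c (vtx k) (w k) f hfall i (f' i)
      have h2 := maximiser_coord c (vtx k) (w k) f' hf'all i (f i)
      have hzero : c ⬝ᵥ (vtx k i (f i) - vtx k i (f' i)) = 0 := by rw [dotProduct_sub]; linarith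
      by_cases hb : BlockConstSymGen β (vtx k i (f i) - vtx k i (f' i))
      · exact hbl k i _ _ hb
      · exfalso
        have hgen : gen (eD (k, (i, (f i, f' i)))) = vtx k i (f i) - vtx k i (f' i) := by
          simp only [gen, Equiv.symm_apply_apply]
        have := hsep (eD (k, (i, (f i, f' i)))) (by rw [hgen]; exact hb)
        rw [hgen] at this
        exact this hzero
    choose α hα using hcoord
    refine ⟨∑ i, α i, ?_⟩
    have : (w k + ∑ i, vtx k i (f i)) - (w k + ∑ i, vtx k i (f' i)) = ∑ i, (vtx k i (f i) - vtx k i (f' i)) := by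
      rw [add_sub_add_left_eq_sub, Finset.sum_sub_distrib]
    rw [this, Finset.sum_smul]
    exact Finset.sum_congr rfl fun i _ => hα i
  have hcnt := labelledFibre_three_pow_le h m' β ρ hρ
    (fun kf : Fin K × (Fin M → Fin m) => w kf.1 + ∑ i, vtx kf.1 i (kf.2 i)) Prod.fst r c hc hthin hEF
  rw [Fintype.card_fin] at hcnt
  calc 3 ^ m' ≤ 2 * K * (r + 1) * 2 ^ m' := hcnt
    _ ≤ 2 * K * (r + 1) * 2 ^ (m' + 1) := Nat.mul_le_mul_left _ (Nat.pow_le_pow_right (by norm_num) (by omega))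

/-- ★★★ **FEW-SUMMANDS LAW FOR UNIONS IN THE CRUX'S SHAPE:** at level `m' = 2L + 4`, `L = (log₂ h + C)^C`, with `K` labels,
`2K·8^L ≤ 9^L` (read: `K ≤ ½·1.125^L` — quasi-polynomially many in `h`): `2^L < r`. [cite: KaibelWeltge2014, Thm. 1] -/
theorem union_summands_decided (C h t K M m : ℕ) (vtx : Fin K → Fin M → Fin m → (Fin h × Fin h → ℝ))
    (w : Fin K → (Fin h × Fin h → ℝ)) (r : ℕ) (ht : 1 ≤ t) (hK : 1 ≤ K) (hm : 1 ≤ m)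
    (hKL : 2 * K * 8 ^ ((Nat.log 2 h + C) ^ C) ≤ 9 ^ ((Nat.log 2 h + C) ^ C))
    (hh : (2 * (Nat.log 2 h + C) ^ C + 4) * t ≤ h)
    (hcount : (K * (M * (m * m))) * Nat.choose (h - t - 1) (t - 1) < Nat.choose (h - 1) (t - 1))
    (hR : HasEFOfSize (corPolytopeGraph (⊤ : SimpleGraph (Fin h)) +
      convexHull ℝ (Set.range fun kf : Fin K × (Fin M → Fin m) => w kf.1 + ∑ i, vtx kf.1 i (kf.2 i))) r) :
    2 ^ ((Nat.log 2 h + C) ^ C) < r := by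
  set L := (Nat.log 2 h + C) ^ C with hLdef
  have hL : 1 ≤ L := one_le_L h C
  have hdec := union_summands_three_pow_le h (2 * L + 4) t K M m vtx w r (by omega) ht hh hK hm hcount hR
  -- `3^(2L+4) = 81·9^L` and `2K(r+1)·2^(2L+5) = 64·(r+1)·K·4^L`
  have h9 : 3 ^ (2 * L + 4) = 81 * 9 ^ L := by
    rw [pow_add, pow_mul, show (3 : ℕ) ^ 2 = 9 by norm_num, show (3 : ℕ) ^ 4 = 81 by norm_num, mul_comm]
  have h4 : 2 * K * (r + 1) * 2 ^ (2 * L + 4 + 1) = 64 * (r + 1) * (K * 4 ^ L) := by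
    have e : 2 ^ (2 * L + 4 + 1) = 32 * 4 ^ L := by
      rw [pow_add, pow_add, pow_mul, show (2 : ℕ) ^ 2 = 4 by norm_num]; ring
    rw [e]; ring
  rw [h9, h4] at hdec
  -- multiply by `2^(L+1)`: `81·9^L·2^(L+1) ≤ 64(r+1)·(2K·8^L) ≤ 64(r+1)·9^L`
  have h8 : K * 4 ^ L * 2 ^ (L + 1) = 2 * K * 8 ^ L := by
    have : (8 : ℕ) ^ L = 4 ^ L * 2 ^ L := by rw [← mul_pow]; norm_num
    rw [this, pow_succ]; ring
  have key : 81 * 9 ^ L * 2 ^ (L + 1) ≤ 64 * (r + 1) * 9 ^ L := by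
    calc 81 * 9 ^ L * 2 ^ (L + 1) ≤ 64 * (r + 1) * (K * 4 ^ L) * 2 ^ (L + 1) := Nat.mul_le_mul_right _ hdec
      _ = 64 * (r + 1) * (2 * K * 8 ^ L) := by rw [mul_assoc (64 * (r + 1)), h8]
      _ ≤ 64 * (r + 1) * 9 ^ L := Nat.mul_le_mul_left _ hKL
  have h9pos : 0 < 9 ^ L := by positivity
  have key' : 81 * 2 ^ (L + 1) ≤ 64 * (r + 1) := by
    have : 81 * 2 ^ (L + 1) * 9 ^ L ≤ 64 * (r + 1) * 9 ^ L := by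
      calc 81 * 2 ^ (L + 1) * 9 ^ L = 81 * 9 ^ L * 2 ^ (L + 1) := by ring
        _ ≤ 64 * (r + 1) * 9 ^ L := key
    exact Nat.le_of_mul_le_mul_right this h9pos
  have h2L : 2 ≤ 2 ^ L := by
    calc 2 = 2 ^ 1 := by norm_num
      _ ≤ 2 ^ L := Nat.pow_le_pow_right (by norm_num) hL
  rw [pow_succ] at key'
  omega

end Summands

end Summit.ValiantsHypothesis.ValiantsHypothesis.Theorems.FifoMatching

end
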